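import Mathlib
import HarnessLib
import Literature.MathematicalPhysics.StatisticalMechanics.LinearisedMapBlockTerm

/-!
# Lemma 10.1 of [ABKM19] in norm form: `‖C^{(q)} K‖_{k+1}^{(A)} ≤ (L^d c'_G + ε(A)) ‖K‖_k^{(A)}`

Assembly of `LinearisedMap.tayNormLE_opC` (the summation/counting skeleton of Lemmas 10.2 and 10.4)
with the two analytic inputs in norm form: the per-block bound `LinearisedMapBlockTerm.tayNormLE_blockTerm`
(Lemmas 10.3–10.4) and the per-polymer bound `tayNormLE_fluct_at_reblock` (Lemma 8.4 + Lemma 8.1 +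
(w6), the `hper` step of `tayNormLE_largePart_fluct`).  Result:

* `tayNormLE_fluct_at_reblock` — `|R K(X)|_{k+1,π(X),T_φ} ≤ C κ^{|X|_k} A^{−|X|_k} w_{k+1}^{π(X)}(φ)`;
* `contDiff_blockTerm`;
* **`weakNormLE_opC`** — `WeakNormLE P k K C → WeakNormLE P (k+1) (opC D K) (C · (L^d c'_G + ε(A)))`
  with `c'_G = 1536 κ c_G` (`blockContrConst`) and `ε(A) = largePartEps d L A κ η`, under the
  hypotheses: integration property (w7) with constant `κ`, (w6), (w9), the closure gain `η`, weights
  local/dominated/monotone, gauge relations of consecutive scales, no-wrap/room for `B*`, `K`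
  translation invariant, local, `C^{r₀}` with `C^{r₀}` fluctuation integrals.

[ABKM19] then fixes `L ≥ L₀` so that `L^d c'_G ≤ θ/2` and `A ≥ A₀(L)` so that `ε(A) ≤ θ/4`
(Lemma 10.1: `‖C^{(q)}‖ ≤ θ`).  Everything here is proved; no named fact.

## References
* S. Adams, S. Buchholz, R. Kotecký, S. Müller, arXiv:1910.13564, Lemma 10.1 (and 10.2–10.4, 8.1,
  8.4, Theorem 7.1 (w6), (w7), (w9)) [AdamsBuchholzKoteckyMuller2019].
-/

noncomputable section

namespace Literature.MathematicalPhysics.StatisticalMechanics.GradientRG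

open scoped BigOperators Classical
open Finset
open Literature.MathematicalPhysics.StatisticalMechanics.TorusPolymer
  (IsPolymer blocks numBlocks closure reblock blockOf thicken card_blocks_eq_numBlocks boxCorner)
open Literature.Barriers.CriticalPhenomena.LongRangePhi4.Polymer (IsConn)
open Literature.MathematicalPhysics.QuantumFieldTheory

variable {d M : ℕ} [NeZero M]

/-- **`|R K(X)|_{k+1,π(X),T_φ} ≤ C κ^{|X|_k} A^{−|X|_k} w_{k+1}^{π(X)}(φ)`** for a connected `k`-polymer
`X` (Lemma 8.4 via `IntegrationProperty`, Lemma 8.1 via `norm_gauge_le_norm_gauge_succ`, (w6) via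
`NextWeightDominates`). [cite: AdamsBuchholzKoteckyMuller2019, Lemma 10.2 (10.6)–(10.7)] -/
theorem tayNormLE_fluct_at_reblock (P : NormParams d M) {k t : ℕ} (hM : M = P.L ^ (k + 1) * t)
    (hL : Odd P.L) (ht : Odd t) (h𝔥 : 0 < P.𝔥 (k + 1)) (h𝔥le : P.𝔥 (k + 1) ≤ P.𝔥 k)
    (hR : 0 < P.R k) (hRle : P.R k ≤ P.R (k + 1)) (hrad : P.rad k ≤ P.rad (k + 1))
    (hrad' : P.rad k + (2 ^ d - 1) * P.L ^ k ≤ P.rad (k + 1)) (hA : 1 ≤ P.A)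
    {𝒞 : (Fin d → ZMod M) → ℝ} {κ : ℝ} (hκ : 0 ≤ κ)
    (hint : IntegrationProperty P k 𝒞 κ) (hw6 : NextWeightDominates P k)
    {K : Finset (Fin d → ZMod M) → ((Fin d → ZMod M) → ℝ) → ℂ} {C : ℝ} (hC : 0 ≤ C)
    (hK : WeakNormLE P k K C) (hKd : ∀ X, ContDiff ℝ P.r₀ (K X))
    (hKloc : ∀ X, IsPolymer (P.L ^ k) X → IsConn X → IsGaugeLocal (P.gauge k X) (K X))
    (hRd : ∀ X, ContDiff ℝ P.r₀ (fluct 𝒞 (K X)))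
    {X : Finset (Fin d → ZMod M)} (hP : IsPolymer (P.L ^ k) X) (hc : IsConn X) :
    TayNormLE (P.gauge (k + 1) (reblock (P.L ^ k) (P.L * P.L ^ k) X)) P.r₀
      (P.W.weight (k + 1) (reblock (P.L ^ k) (P.L * P.L ^ k) X)) (fluct 𝒞 (K X))
      (C * (κ ^ (blocks (P.L ^ k) X).card * (P.A ^ (blocks (P.L ^ k) X).card)⁻¹)) := by
  have hMk : M = P.L ^ k * (P.L * t) := hM.trans (by rw [pow_succ]; ring)
  have hA0 : 0 < P.A := by linarith
  set U := reblock (P.L ^ k) (P.L * P.L ^ k) X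
  have h1 := hint X hP hc (K X) (C * P.aFactor k X)
    (mul_nonneg hC (WeakNormLE.aFactor_pos hA0 k X).le) (hKd X) (hKloc X hP hc) (hK X hP hc)
  have hloc : IsGaugeLocal (P.gauge k X) (fluct 𝒞 (K X)) :=
    isGaugeLocal_integral (P.gauge k X) (stepMeasure 𝒞) fun ξ => (hKloc X hP hc).comp_add_right _ ξ
  have h2 : TayNormLE (P.gauge (k + 1) U) P.r₀ (P.W.midWeight k X) (fluct 𝒞 (K X))
      (C * P.aFactor k X * κ ^ numBlocks (P.L ^ k) X) :=
    h1.of_le_gauge (fun ξ => norm_gauge_le_norm_gauge_succ P hMk hL (hL.mul ht) h𝔥 h𝔥le hR hRle hrad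
      hrad' X ξ) (hRd X) hloc
  have hc0 : 0 ≤ C * P.aFactor k X * κ ^ numBlocks (P.L ^ k) X :=
    mul_nonneg (mul_nonneg hC (WeakNormLE.aFactor_pos hA0 k X).le) (pow_nonneg hκ _)
  have h3 : TayNormLE (P.gauge (k + 1) U) P.r₀ (P.W.weight (k + 1) U) (fluct 𝒞 (K X))
      (C * P.aFactor k X * κ ^ numBlocks (P.L ^ k) X) :=
    h2.mono_weight hc0 fun φ => hw6 X hP hc φ
  refine h3.mono (le_of_eq ?_) fun φ => (P.W.weight_pos (k + 1) U φ).le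
  rw [NormParams.aFactor, ← card_blocks_eq_numBlocks]; ring

/-- The block terms are `C^{r₀}` when the fluctuation integrals are. [cite: AdamsBuchholzKoteckyMuller2019, Ch. 10.1 (10.4)] -/
theorem contDiff_blockTerm (D : StepData d M) {K : Finset (Fin d → ZMod M) → ((Fin d → ZMod M) → ℝ) → ℂ}
    {n : ℕ} (hRd : ∀ X, ContDiff ℝ n (fluct D.𝒞 (K X))) (B : Finset (Fin d → ZMod M)) :
    ContDiff ℝ n (blockTerm D K B) := by
  have : blockTerm D K B = fun φ => fluct D.𝒞 (K B) φ + eval (opB D K) B φ := rfl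
  rw [this]
  exact (hRd B).add (contDiff_eval _ _)

/-- `c_G ≥ 0`. [cite: AdamsBuchholzKoteckyMuller2019, Lemma 10.3 (10.10)] -/
theorem blockContrConst_nonneg (d : ℕ) {𝔥 𝔥' R R' L κ C₁ C₀ : ℝ} (h𝔥 : 0 < 𝔥) (h𝔥' : 0 ≤ 𝔥')
    (hR : 0 ≤ R) (hR' : 0 < R') (hL : 0 < L) (hκ : 0 ≤ κ) (hC₁ : 0 ≤ C₁) (hC₀ : 0 ≤ C₀) :
    0 ≤ blockContrConst d 𝔥 𝔥' R R' L κ C₁ C₀ := by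
  unfold blockContrConst pi2ContrFactor
  have := pi2BoundConst_nonneg d hC₀
  positivity

/-- **Lemma 10.1 (norm form): `‖C^{(q)}K‖_{k+1}^{(A)} ≤ (L^d c'_G + ε(A)) ‖K‖_k^{(A)}`.**
[cite: AdamsBuchholzKoteckyMuller2019, Lemma 10.1] -/
theorem weakNormLE_opC (P : NormParams d M) {k t : ℕ} (hM : M = P.L ^ (k + 1) * t)
    (hL : Odd P.L) (ht : Odd t) (D : StepData d M) (hDs : D.s = P.L ^ k) (hDL : D.L = P.L)
    {x₀ : Fin d → ZMod M} (hB₀ : D.B₀ = blockOf (P.L ^ k) x₀)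
    (hc₀ : D.c₀ = boxCorner (P.L ^ k) (P.rad k) x₀) (hC𝒞 : (Matrix.circulant D.𝒞).PosSemidef)
    -- gauges of the two scales
    (h𝔥 : 0 < P.𝔥 (k + 1)) (h𝔥le : P.𝔥 (k + 1) ≤ P.𝔥 k) {κ₁ : ℝ} (hκ₁ : P.𝔥 (k + 1) ≤ κ₁ * P.𝔥 k)
    (hR : 0 < P.R k) (hRsucc : P.R (k + 1) = P.L * P.R k)
    (hθ : P.𝔥 (k + 1) / P.𝔥 k * (P.R k / P.R (k + 1)) ≤ 1)
    (hp : d / 2 + 2 ≤ P.p) (hr₀ : 3 ≤ P.r₀) (hrad : P.rad k ≤ P.rad (k + 1))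
    (hrad' : P.rad k + (2 ^ d - 1) * P.L ^ k ≤ P.rad (k + 1))
    -- the box `B*`
    (hwrap : 4 * ((P.L ^ k - 1) / 2 + P.rad k) < M)
    (hroom : ((2 * ((P.L ^ k - 1) / 2 + P.rad k) : ℕ) + (P.p : ℤ)) * 2 < M)
    {C₁ C₀ : ℝ} (hC₁ : 0 ≤ C₁) (hρ : ((2 * ((P.L ^ k - 1) / 2 + P.rad k) : ℕ) : ℝ) ≤ C₁ * P.R k)
    (hC₀ : 1 ≤ C₀) (hρ0 : ((2 * ((P.L ^ k - 1) / 2 + P.rad k) : ℕ) : ℝ) + (d / 2 + 1 : ℕ) ≤ C₀ * P.R k)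
    -- weights
    {nb : ℕ → Finset (Fin d → ZMod M) → Finset (Fin d → ZMod M)} (hWl : P.W.Local nb)
    (hnb : ∀ X, nb k X ⊆ thicken (P.rad k) X)
    {Dm : ℕ → Matrix (Fin d → ZMod M) (Fin d → ZMod M) ℝ} (hWd : P.W.Dominated Dm) (hWm : P.W.Monotone)
    (hw6 : NextWeightDominates P k) (hw9 : ∀ U, IsPolymer (P.L ^ (k + 1)) U → W9At P k U)
    -- integration property, large-set parameter, gain
    {κ η : ℝ} (hκ : 0 ≤ κ) (hκA : κ ≤ P.A) (hA : 1 ≤ P.A) (hη : 0 < η)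
    (hint : IntegrationProperty P k D.𝒞 κ)
    (hsmall : (2 : ℝ) ^ (P.L ^ d) * (κ * P.A ^ (-(1 - η⁻¹) : ℝ)) ≤ 1)
    (hgain : ∀ X : Finset (Fin d → ZMod M), IsPolymer (P.L ^ k) X → IsConn X →
      2 ^ d < (blocks (P.L ^ k) X).card →
        η * ((blocks (P.L * P.L ^ k) (closure (P.L * P.L ^ k) X)).card : ℝ) ≤ (blocks (P.L ^ k) X).card)
    -- the activity
    {K : Finset (Fin d → ZMod M) → ((Fin d → ZMod M) → ℝ) → ℂ} {C : ℝ} (hC : 0 ≤ C)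
    (hK : WeakNormLE P k K C) (hKt : TransInv D.s K) (hKd : ∀ X, ContDiff ℝ P.r₀ (K X))
    (hKloc : ∀ X, IsPolymer (P.L ^ k) X → IsConn X → IsGaugeLocal (P.gauge k X) (K X))
    (hRd : ∀ X, ContDiff ℝ P.r₀ (fluct D.𝒞 (K X))) :
    WeakNormLE P (k + 1) (opC D K)
      (C * ((P.L : ℝ) ^ d * (1536 * κ * blockContrConst d (P.𝔥 k) (P.𝔥 (k + 1)) (P.R k) (P.R (k + 1))
        P.L κ₁ C₁ C₀) + largePartEps d P.L P.A κ η)) := by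
  intro U hU hcU
  have hLs : P.L * P.L ^ k = P.L ^ (k + 1) := (pow_succ' P.L k).symm
  have hLDs : D.L * D.s = P.L ^ (k + 1) := by rw [hDL, hDs, hLs]
  have hM' : M = D.L * D.s * t := hM.trans (by rw [hLDs])
  have hRle : P.R k ≤ P.R (k + 1) := by
    rw [hRsucc]
    have h1 : (1 : ℝ) ≤ P.L := by exact_mod_cast hL.pos
    nlinarith
  set cG := 1536 * κ * blockContrConst d (P.𝔥 k) (P.𝔥 (k + 1)) (P.R k) (P.R (k + 1)) P.L κ₁ C₁ C₀
    with hcG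
  -- the per-block bounds (Lemmas 10.3–10.4)
  have hG : ∀ B ∈ blockPartIndex D U, TayNormLE (P.gauge (k + 1) U) P.r₀ (P.W.weight (k + 1) U)
      (blockTerm D K B) (C * cG * P.A⁻¹) := fun B hB =>
    tayNormLE_blockTerm P hM hL ht D hDs hB₀ hc₀ hC𝒞 h𝔥 h𝔥le hκ₁ hR hRsucc hθ hp hr₀ hrad hwrap
      hroom hC₁ hρ hC₀ hρ0 hWl hnb hWd hWm hκ hint hC hK hKt hKd hKloc hRd hA (hw9 U hU) hB
  have hκ₁0 : 0 ≤ κ₁ := ((mul_pos_iff_of_pos_right (h𝔥.trans_le h𝔥le)).1 (h𝔥.trans_le hκ₁)).le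
  have hcG0 : 0 ≤ cG := by
    have := blockContrConst_nonneg d (h𝔥.trans_le h𝔥le) h𝔥.le hR.le (hR.trans_le hRle)
      (show (0 : ℝ) < (P.L : ℝ) by exact_mod_cast hL.pos) hκ₁0 hC₁ (show (0 : ℝ) ≤ C₀ by linarith)
    rw [hcG]; positivity
  -- the per-polymer bounds (Lemma 8.4 + 8.1 + (w6))
  have hRb : ∀ X ∈ largePartIndex D.s D.L U, TayNormLE (P.gauge (k + 1) U) P.r₀ (P.W.weight (k + 1) U)
      (fluct D.𝒞 (K X)) (C * (κ ^ (blocks D.s X).card * (P.A ^ (blocks D.s X).card)⁻¹)) := by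
    intro X hX
    obtain ⟨hPX, hcX, -, hr⟩ := mem_largePartIndex.1 hX
    rw [hDs] at hPX hr ⊢
    rw [hDL] at hr
    rw [← hr]
    exact tayNormLE_fluct_at_reblock P hM hL ht h𝔥 h𝔥le hR hRle hrad hrad' hA hκ hint hw6 hC hK hKd
      hKloc hRd hPX hcX
  have hmain := tayNormLE_opC D hM' (hDs ▸ hL.pow) (hDL ▸ hL) ht (P.gauge (k + 1) U)
    (w := P.W.weight (k + 1) U) (fun φ => (P.W.weight_pos (k + 1) U φ).le) (K := K) hA hκ hκA hη hC
    hcG0 (by rwa [hDL]) (by rw [hDs, hDL]; exact hgain) (by rwa [hLDs]) hcU.1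
    (fun B _ => contDiff_blockTerm D hRd B) hG (fun X _ => hRd X) hRb
  refine hmain.mono (le_of_eq ?_) fun φ => (P.W.weight_pos (k + 1) U φ).le
  rw [NormParams.aFactor, ← card_blocks_eq_numBlocks, hLDs, hDL]

end Literature.MathematicalPhysics.StatisticalMechanics.GradientRG

end
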